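import Literature.AnabelianGeometry.AbsoluteAnabelian.AbsAnabLemma114Proofs
import Literature.AnabelianGeometry.AbsoluteAnabelian.AbsTopIRankFormulaProofs
import HarnessLib

/-!
# [AbsAnab] Lemma 1.1.4 (ii): unconditional discharge

S. Mochizuki, *The Absolute Anabelian Geometry of Hyperbolic Curves* (2004) [AbsAnab], Lemma
1.1.4 (ii), manuscript p. 7 (held text `paper:doi-10-1007-978-1-4613-0249-0-5`; kurims key
`paper:url-e8f118cc205e`, same pagination):

  "`[G : G′] · [F_𝔭 : ℚ_p] = dim_{ℚ_p}((Π′)^{ab} ⊗_ℤ ℚ_p) − dim_{ℚ_l}((Π′)^{ab} ⊗_ℤ ℚ_l)`".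

abc-iut-L4-t4's closed named facts `FundamentalExtension.lemma114_ii` (the lemma as printed, over
MLF base data) and `FundamentalExtension.lemma114_ii_reduction` (the p. 8 reduction step) are
PROVED here unconditionally, by feeding abc-iut-L4-t4's theorem `thm26_ii_delta_gal_holds` (the
rank formula of local class field theory, [AbsTopI] Thm 2.6 (ii), `AbsTopIRankFormulaProofs`) into
this seat's `lemma114_ii_of_thm26_ii_delta_gal` / `lemma114_ii_reduction_of_thm26_ii_delta_gal`
(`AbsAnabLemma114Proofs`).  Proof-only; no definitions.

HONEST FRAMING: a classical, refereed lemma (Tamagawa), now a kernel theorem of the tree; nothing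
here bears on [IUTchIII] Cor. 3.12; typed ≠ discharged elsewhere.
-/

noncomputable section

namespace Literature.AnabelianGeometry.AbsoluteAnabelian

namespace FundamentalExtension

/-- **[AbsAnab] Lemma 1.1.4 (ii) (Tamagawa), PROVED**: for every extension `1 → Δ → Π → G → 1` with
`G ≅ G_K` (`K/ℚ_p` finite) that splits over an open subgroup of `G`, with `Δ` topologically finitely
generated and satisfying (∗), and every open `Π′ ⊆ Π` with image `G′`,
"`[G : G′] · [F_𝔭 : ℚ_p] = dim_{ℚ_p}((Π′)^{ab} ⊗_ℤ ℚ_p) − dim_{ℚ_l}((Π′)^{ab} ⊗_ℤ ℚ_l)`" (`l ≠ p`).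
[cite: MochizukiAbsAnab2004, Lemma 1.1.4 (ii) p.7] -/
theorem lemma114_ii_holds : lemma114_ii :=
  lemma114_ii_of_thm26_ii_delta_gal thm26_ii_delta_gal_holds

/-- The p. 8 reduction step of [AbsAnab] Lemma 1.1.4 (ii) (`lemma114_ii_reduction`), PROVED
unconditionally (no finite-generation hypothesis on `G_K`).
[cite: MochizukiAbsAnab2004, Lemma 1.1.4 (ii) proof p.8] -/
theorem lemma114_ii_reduction_holds : lemma114_ii_reduction :=
  lemma114_ii_reduction_of_thm26_ii_delta_gal thm26_ii_delta_gal_holds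

/-- [AbsAnab] Lemma 1.1.4 (ii), first half, unconditionally in the printed MLF-base setting:
splitting over an open subgroup of `G ≅ G_K` and (∗) imply `CoinvariantRankConstant`
("`dim_{ℚ_l}((Π′)^{ab} ⊗_ℤ ℚ_l) − dim_{ℚ_l}((G′)^{ab} ⊗_ℤ ℚ_l)` independent of `l`", our gloss of
p. 8). [cite: MochizukiAbsAnab2004, Lemma 1.1.4 (ii) proof p.8] -/
theorem coinvariantRankConstant_of_mlfBase (E : FundamentalExtension.{0}) (B : E.MLFBase)
    (hs : E.SplitsOverOpenSubgroup) (hstar : E.StarCondition) : E.CoinvariantRankConstant :=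
  coinvariantRankConstant_of_rank thm26_ii_delta_gal_holds E B hs hstar

end FundamentalExtension

end Literature.AnabelianGeometry.AbsoluteAnabelian
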